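import Summits.CriticalPhenomena.SAWScalingLimit.Theorems.SAWDefectDecoherenceBoundaryClosureRInnerZigzagCells
import Summits.CriticalPhenomena.SAWScalingLimit.Theorems.SAWDefectDecoherenceBoundaryClosureRInnerZigzagLevels
import HarnessLib

/-!
# Crux `BoundaryClosureR` (stmt-CriticalPhenomena-14004), line `polygon-parity-squeeze`,
# stub `stub_innerZigzagPolygon` (7a): the open RHOMBUS of two adjacent faces of `𝕋` and the
# two open cells along an edge

Landing target:
`Summits/CriticalPhenomena/SAWScalingLimit/Theorems/SAWDefectDecoherenceBoundaryClosureRInnerZigzagEdges.lean`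
(`--supports stmt-CriticalPhenomena-14004`; building block A2 of the registered stub
`stub_innerZigzagPolygon`, the continuum half of the inner-polygon construction (IP)).

Sequel of `…InnerZigzagCells.lean`: two faces sharing an edge, both in `K` or both off `K`, are on the
same side of the boundary cycle because the open RHOMBUS they span is convex and misses the cycle;
along a boundary edge, off its endpoints, a small ball splits into open left cell / edge / open right
cell.  This file proves the two coordinate facts:

* `openRhombus y i` (data: an open parallelogram in two of the three relative lattice forms),
  `mem_openRhombus_iff`, `convex_openRhombus`, `triCellStrict_subset_openRhombus`,
  `eq_faceL_of_mem_openRhombus` — convex, contains both open cells, meets no other closed cell;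
* `edge_trichotomy` / `edge_cells` — for `z = triEmbed b + θ·triEmbed (triDir m)`,
  `4‖w - z‖ < min θ (1 - θ)`: open left cell `faceL b m` / closed edge / open right cell `faceL b (m+5)`
  according to the sign of the level against `innerNormal (σ m)`, `σ = ![0,3,5,1,2,4]`.

Sources: folklore plane geometry of the triangular lattice.  No proposition is defined and no named
fact is introduced. -/

noncomputable section

open scoped ComplexConjugate
open Set Metric
open Literature.Probability.LatticeModels
open Literature.Probability.Percolation (triX triY triCell triCellStrict cellForm triX_triEmbed triY_triEmbed triX_add
  triY_add triX_sub triY_sub triX_smul triY_smul mem_triCell_iff mem_triCellStrict_iff coords_of_mem_triCell triDir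
  triXY_ext triDir_fst_cast triDir_snd_cast abs_triX_sub_le abs_triY_sub_le)
open Literature.Probability.RandomPlanarGeometry.SAW (site_two_eq_iff)
open Summit.CriticalPhenomena.SAWScalingLimit.Theorems.PolygonParitySqueeze.BoundaryWalk

namespace Summit.CriticalPhenomena.SAWScalingLimit.Theorems.PolygonParitySqueeze.InnerZigzag

/-! ### 1. Open cells round a vertex and the open rhombus of two adjacent faces -/

/-- **The six open cells round a vertex in relative lattice coordinates** `U = X(w) - y₀`,
`V = Y(w) - y₁`. [folklore] -/
theorem triCellStrict_faceL_iff (y : Site 2) (w : ℂ) :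
    (w ∈ triCellStrict (faceL y 0) ↔ 0 < triX w - y 0 ∧ 0 < triY w - y 1 ∧ (triX w - y 0) + (triY w - y 1) < 1) ∧
    (w ∈ triCellStrict (faceL y 1) ↔ triX w - y 0 < 0 ∧ 0 < (triX w - y 0) + (triY w - y 1) ∧ triY w - y 1 < 1) ∧
    (w ∈ triCellStrict (faceL y 2) ↔ (triX w - y 0) + (triY w - y 1) < 0 ∧ 0 < triY w - y 1 ∧ -1 < triX w - y 0) ∧
    (w ∈ triCellStrict (faceL y 3) ↔ triX w - y 0 < 0 ∧ triY w - y 1 < 0 ∧ -1 < (triX w - y 0) + (triY w - y 1)) ∧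
    (w ∈ triCellStrict (faceL y 4) ↔ 0 < triX w - y 0 ∧ (triX w - y 0) + (triY w - y 1) < 0 ∧ -1 < triY w - y 1) ∧
    (w ∈ triCellStrict (faceL y 5) ↔ triY w - y 1 < 0 ∧ 0 < (triX w - y 0) + (triY w - y 1) ∧ triX w - y 0 < 1) := by
  obtain ⟨f0, f1, f2, f3, f4, f5⟩ := faceL_eq y
  obtain ⟨⟨a0, a1, a2⟩, ⟨b0, b1, b2⟩, ⟨c0, c1, c2⟩, ⟨d0, d1, d2⟩, ⟨e0, e1, e2⟩, ⟨g0, g1, g2⟩⟩ :=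
    cellForm_vertexFace y w
  rw [f0, f1, f2, f3, f4, f5]
  have three : ∀ {Q : Fin 3 → Prop}, (∀ j, Q j) ↔ Q 0 ∧ Q 1 ∧ Q 2 :=
    ⟨fun h => ⟨h 0, h 1, h 2⟩, fun h j => by fin_cases j <;> simp [h.1, h.2.1, h.2.2]⟩
  simp only [mem_triCellStrict_iff, three, a0, a1, a2, b0, b1, b2, c0, c1, c2, d0, d1, d2, e0,
    e1, e2, g0, g1, g2]
  refine ⟨?_, ?_, ?_, ?_, ?_, ?_⟩ <;> constructor <;> rintro ⟨h1, h2, h3⟩ <;> exact ⟨by linarith, by linarith, by linarith⟩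

/-- The three lattice forms are subtractive. [folklore] -/
theorem lform_sub (j : Fin 3) (w v : ℂ) : Literature.Probability.Percolation.lform j (w - v) =
    Literature.Probability.Percolation.lform j w - Literature.Probability.Percolation.lform j v := by
  fin_cases j <;> simp [Literature.Probability.Percolation.lform, triX_sub, triY_sub] ; ring

/-- The three lattice forms are `ℝ`-linear. [folklore] -/
theorem isLinearMap_lform (j : Fin 3) : IsLinearMap ℝ (Literature.Probability.Percolation.lform j) := by
  refine ⟨fun w v => ?_, fun c w => ?_⟩
  · fin_cases j <;> simp [Literature.Probability.Percolation.lform, triX_add, triY_add]; ring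
  · fin_cases j <;> simp [Literature.Probability.Percolation.lform, Complex.real_smul, triX_smul, triY_smul]; ring

/-- **The open rhombus of the two adjacent faces `faceL y i`, `faceL y (i+1)`** (data: the open
parallelogram `A < f < A + 1, B < g < B + 1` for two of the three relative lattice forms
`U, V, U + V`; table: `i = 0: 0<V<1, 0<U+V<1`; `1: -1<U<0, 0<V<1`; `2: -1<U<0, -1<U+V<0`;
`3: -1<V<0, -1<U+V<0`; `4: 0<U<1, -1<V<0`; `5: 0<U<1, 0<U+V<1`). [folklore] -/
def openRhombus (y : Site 2) (i : Fin 6) : Set ℂ :=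
  {w : ℂ | ((![0, -1, -1, -1, 0, 0] : Fin 6 → ℝ) i) <
        Literature.Probability.Percolation.lform (![1, 0, 0, 1, 0, 0] i) (w - triEmbed y) ∧
      Literature.Probability.Percolation.lform (![1, 0, 0, 1, 0, 0] i) (w - triEmbed y) <
        (![0, -1, -1, -1, 0, 0] : Fin 6 → ℝ) i + 1 ∧
      ((![0, 0, -1, -1, -1, 0] : Fin 6 → ℝ) i) <
        Literature.Probability.Percolation.lform (![2, 1, 2, 2, 1, 2] i) (w - triEmbed y) ∧
      Literature.Probability.Percolation.lform (![2, 1, 2, 2, 1, 2] i) (w - triEmbed y) <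
        (![0, 0, -1, -1, -1, 0] : Fin 6 → ℝ) i + 1}

/-- **Membership in the open rhombi, in relative lattice coordinates.** [folklore] -/
theorem mem_openRhombus_iff (y : Site 2) (w : ℂ) :
    (w ∈ openRhombus y 0 ↔ 0 < triY w - y 1 ∧ triY w - y 1 < 1 ∧
      0 < (triX w - y 0) + (triY w - y 1) ∧ (triX w - y 0) + (triY w - y 1) < 1) ∧
    (w ∈ openRhombus y 1 ↔ -1 < triX w - y 0 ∧ triX w - y 0 < 0 ∧ 0 < triY w - y 1 ∧ triY w - y 1 < 1) ∧
    (w ∈ openRhombus y 2 ↔ -1 < triX w - y 0 ∧ triX w - y 0 < 0 ∧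
      -1 < (triX w - y 0) + (triY w - y 1) ∧ (triX w - y 0) + (triY w - y 1) < 0) ∧
    (w ∈ openRhombus y 3 ↔ -1 < triY w - y 1 ∧ triY w - y 1 < 0 ∧
      -1 < (triX w - y 0) + (triY w - y 1) ∧ (triX w - y 0) + (triY w - y 1) < 0) ∧
    (w ∈ openRhombus y 4 ↔ 0 < triX w - y 0 ∧ triX w - y 0 < 1 ∧ -1 < triY w - y 1 ∧ triY w - y 1 < 0) ∧
    (w ∈ openRhombus y 5 ↔ 0 < triX w - y 0 ∧ triX w - y 0 < 1 ∧
      0 < (triX w - y 0) + (triY w - y 1) ∧ (triX w - y 0) + (triY w - y 1) < 1) := by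
  simp only [openRhombus, mem_setOf_eq, Literature.Probability.Percolation.lform, triX_sub, triY_sub,
    triX_triEmbed, triY_triEmbed]
  simp

/-- **The open rhombus is convex** (an intersection of four open half-spaces of linear forms).
[folklore] -/
theorem convex_openRhombus (y : Site 2) (i : Fin 6) : Convex ℝ (openRhombus y i) := by
  have e : openRhombus y i =
      ({w : ℂ | (![0, -1, -1, -1, 0, 0] : Fin 6 → ℝ) i +
            Literature.Probability.Percolation.lform (![1, 0, 0, 1, 0, 0] i) (triEmbed y) <
          Literature.Probability.Percolation.lform (![1, 0, 0, 1, 0, 0] i) w} ∩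
        {w : ℂ | Literature.Probability.Percolation.lform (![1, 0, 0, 1, 0, 0] i) w <
          (![0, -1, -1, -1, 0, 0] : Fin 6 → ℝ) i + 1 +
            Literature.Probability.Percolation.lform (![1, 0, 0, 1, 0, 0] i) (triEmbed y)}) ∩
      ({w : ℂ | (![0, 0, -1, -1, -1, 0] : Fin 6 → ℝ) i +
            Literature.Probability.Percolation.lform (![2, 1, 2, 2, 1, 2] i) (triEmbed y) <
          Literature.Probability.Percolation.lform (![2, 1, 2, 2, 1, 2] i) w} ∩
        {w : ℂ | Literature.Probability.Percolation.lform (![2, 1, 2, 2, 1, 2] i) w <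
          (![0, 0, -1, -1, -1, 0] : Fin 6 → ℝ) i + 1 +
            Literature.Probability.Percolation.lform (![2, 1, 2, 2, 1, 2] i) (triEmbed y)}) := by
    ext w
    simp only [openRhombus, mem_setOf_eq, mem_inter_iff, lform_sub]
    constructor
    · rintro ⟨h1, h2, h3, h4⟩; exact ⟨⟨by linarith, by linarith⟩, by linarith, by linarith⟩
    · rintro ⟨⟨h1, h2⟩, h3, h4⟩; exact ⟨by linarith, by linarith, by linarith, by linarith⟩
  rw [e]
  exact ((convex_halfSpace_gt (isLinearMap_lform _) _).inter (convex_halfSpace_lt (isLinearMap_lform _) _)).inter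
    ((convex_halfSpace_gt (isLinearMap_lform _) _).inter (convex_halfSpace_lt (isLinearMap_lform _) _))

/-- **Both open cells lie in the open rhombus.** [folklore] -/
theorem triCellStrict_subset_openRhombus (y : Site 2) (i : Fin 6) :
    triCellStrict (faceL y i) ⊆ openRhombus y i ∧ triCellStrict (faceL y (i + 1)) ⊆ openRhombus y i := by
  constructor <;> intro w hw
  · obtain ⟨s0, s1, s2, s3, s4, s5⟩ := triCellStrict_faceL_iff y w
    obtain ⟨r0, r1, r2, r3, r4, r5⟩ := mem_openRhombus_iff y w
    fin_cases i
    · obtain ⟨h1, h2, h3⟩ := s0.1 hw; exact r0.2 ⟨by linarith, by linarith, by linarith, by linarith⟩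
    · obtain ⟨h1, h2, h3⟩ := s1.1 hw; exact r1.2 ⟨by linarith, by linarith, by linarith, by linarith⟩
    · obtain ⟨h1, h2, h3⟩ := s2.1 hw; exact r2.2 ⟨by linarith, by linarith, by linarith, by linarith⟩
    · obtain ⟨h1, h2, h3⟩ := s3.1 hw; exact r3.2 ⟨by linarith, by linarith, by linarith, by linarith⟩
    · obtain ⟨h1, h2, h3⟩ := s4.1 hw; exact r4.2 ⟨by linarith, by linarith, by linarith, by linarith⟩
    · obtain ⟨h1, h2, h3⟩ := s5.1 hw; exact r5.2 ⟨by linarith, by linarith, by linarith, by linarith⟩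
  · obtain ⟨s0, s1, s2, s3, s4, s5⟩ := triCellStrict_faceL_iff y w
    obtain ⟨r0, r1, r2, r3, r4, r5⟩ := mem_openRhombus_iff y w
    fin_cases i
    · obtain ⟨h1, h2, h3⟩ := s1.1 hw; exact r0.2 ⟨by linarith, by linarith, by linarith, by linarith⟩
    · obtain ⟨h1, h2, h3⟩ := s2.1 hw; exact r1.2 ⟨by linarith, by linarith, by linarith, by linarith⟩
    · obtain ⟨h1, h2, h3⟩ := s3.1 hw; exact r2.2 ⟨by linarith, by linarith, by linarith, by linarith⟩
    · obtain ⟨h1, h2, h3⟩ := s4.1 hw; exact r3.2 ⟨by linarith, by linarith, by linarith, by linarith⟩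
    · obtain ⟨h1, h2, h3⟩ := s5.1 hw; exact r4.2 ⟨by linarith, by linarith, by linarith, by linarith⟩
    · obtain ⟨h1, h2, h3⟩ := s0.1 (by simpa using hw)
      exact r5.2 ⟨by linarith, by linarith, by linarith, by linarith⟩

/-- The open rhombus is not empty: it contains the centre of `faceL y i`. [folklore] -/
theorem hexCenter_mem_openRhombus (y : Site 2) (i : Fin 6) : hexCenter (faceL y i) ∈ openRhombus y i :=
  (triCellStrict_subset_openRhombus y i).1 (hexCenter_mem_triCellStrict _)

/-- The five coordinate constraints of a closed cell. [folklore] -/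
theorem coords5_of_mem_triCell {G : HexVertex} {w : ℂ} (h : w ∈ triCell G) :
    (G.1 0 : ℝ) ≤ triX w ∧ triX w ≤ G.1 0 + 1 ∧ (G.1 1 : ℝ) ≤ triY w ∧ triY w ≤ G.1 1 + 1 ∧
      ((G.2 = 0 ∧ triX w + triY w ≤ (G.1 0 : ℝ) + G.1 1 + 1) ∨ (G.2 = 1 ∧ (G.1 0 : ℝ) + G.1 1 + 1 ≤ triX w + triY w)) := by
  obtain ⟨h1, h2, h3, h4⟩ := coords_of_mem_triCell h
  refine ⟨h1, h2, h3, h4, ?_⟩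
  obtain ⟨x, t⟩ := G
  have h0 := h 0
  have h1' := h 1
  fin_cases t
  · left; simp [cellForm] at h0; exact ⟨rfl, by simpa using h0⟩
  · right; simp [cellForm] at h1'; exact ⟨rfl, by simpa using h1'⟩

/-- **A closed cell meeting the open rhombus is one of its two faces.** [folklore] -/
theorem eq_faceL_of_mem_openRhombus (y : Site 2) (i : Fin 6) (w : ℂ) (G : HexVertex)
    (hw : w ∈ openRhombus y i) (hG : w ∈ triCell G) : G = faceL y i ∨ G = faceL y (i + 1) := by
  have int_eq_of_lt_of_lt : ∀ {a b : ℤ}, (a : ℝ) < b + 1 → (b : ℝ) < a + 1 → a = b := fun {a b} h1 h2 => by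
    have h1' : a < b + 1 := by exact_mod_cast h1
    have h2' : b < a + 1 := by exact_mod_cast h2
    omega
  obtain ⟨f0, f1, f2, f3, f4, f5⟩ := faceL_eq y
  obtain ⟨r0, r1, r2, r3, r4, r5⟩ := mem_openRhombus_iff y w
  obtain ⟨g1, g2, g3, g4, hty⟩ := coords5_of_mem_triCell hG
  obtain ⟨x, t⟩ := G
  simp only at g1 g2 g3 g4 hty
  fin_cases i
  · obtain ⟨h1, h2, h3, h4⟩ := r0.1 hw
    show (x, t) = faceL y 0 ∨ (x, t) = faceL y (0 + 1)
    rw [f0, show (0 : Fin 6) + 1 = 1 from rfl, f1]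
    have e1 : x 1 = y 1 := int_eq_of_lt_of_lt (by linarith) (by linarith)
    have e1' : (x 1 : ℝ) = y 1 := by exact_mod_cast e1
    rcases hty with ⟨rfl, h5⟩ | ⟨rfl, h5⟩
    · left
      have e0 : x 0 = y 0 := int_eq_of_lt_of_lt (by linarith) (by linarith)
      simp [Prod.ext_iff, site_two_eq_iff, e0, e1]
    · right
      have e0 : x 0 = y 0 - 1 := int_eq_of_lt_of_lt (by push_cast; linarith) (by push_cast; linarith)
      simp [Prod.ext_iff, site_two_eq_iff, e0, e1]
  · obtain ⟨h1, h2, h3, h4⟩ := r1.1 hw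
    show (x, t) = faceL y 1 ∨ (x, t) = faceL y (1 + 1)
    rw [f1, show (1 : Fin 6) + 1 = 2 from rfl, f2]
    have e0 : x 0 = y 0 - 1 := int_eq_of_lt_of_lt (by push_cast; linarith) (by push_cast; linarith)
    have e1 : x 1 = y 1 := int_eq_of_lt_of_lt (by linarith) (by linarith)
    rcases hty with ⟨rfl, -⟩ | ⟨rfl, -⟩
    · right; simp [Prod.ext_iff, site_two_eq_iff, e0, e1]
    · left; simp [Prod.ext_iff, site_two_eq_iff, e0, e1]
  · obtain ⟨h1, h2, h3, h4⟩ := r2.1 hw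
    show (x, t) = faceL y 2 ∨ (x, t) = faceL y (2 + 1)
    rw [f2, show (2 : Fin 6) + 1 = 3 from rfl, f3]
    have e0 : x 0 = y 0 - 1 := int_eq_of_lt_of_lt (by push_cast; linarith) (by push_cast; linarith)
    have e0' : (x 0 : ℝ) = y 0 - 1 := by exact_mod_cast e0
    rcases hty with ⟨rfl, h5⟩ | ⟨rfl, h5⟩
    · left
      have e1 : x 1 = y 1 := int_eq_of_lt_of_lt (by linarith) (by linarith)
      simp [Prod.ext_iff, site_two_eq_iff, e0, e1]
    · right
      have e1 : x 1 = y 1 - 1 := int_eq_of_lt_of_lt (by push_cast; linarith) (by push_cast; linarith)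
      simp [Prod.ext_iff, site_two_eq_iff, e0, e1, sub_sub]
  · obtain ⟨h1, h2, h3, h4⟩ := r3.1 hw
    show (x, t) = faceL y 3 ∨ (x, t) = faceL y (3 + 1)
    rw [f3, show (3 : Fin 6) + 1 = 4 from rfl, f4]
    have e1 : x 1 = y 1 - 1 := int_eq_of_lt_of_lt (by push_cast; linarith) (by push_cast; linarith)
    have e1' : (x 1 : ℝ) = y 1 - 1 := by exact_mod_cast e1
    rcases hty with ⟨rfl, h5⟩ | ⟨rfl, h5⟩
    · right
      have e0 : x 0 = y 0 := int_eq_of_lt_of_lt (by linarith) (by linarith)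
      simp [Prod.ext_iff, site_two_eq_iff, e0, e1]
    · left
      have e0 : x 0 = y 0 - 1 := int_eq_of_lt_of_lt (by push_cast; linarith) (by push_cast; linarith)
      simp [Prod.ext_iff, site_two_eq_iff, e0, e1, sub_sub]
  · obtain ⟨h1, h2, h3, h4⟩ := r4.1 hw
    show (x, t) = faceL y 4 ∨ (x, t) = faceL y (4 + 1)
    rw [f4, show (4 : Fin 6) + 1 = 5 from rfl, f5]
    have e0 : x 0 = y 0 := int_eq_of_lt_of_lt (by linarith) (by linarith)
    have e1 : x 1 = y 1 - 1 := int_eq_of_lt_of_lt (by push_cast; linarith) (by push_cast; linarith)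
    rcases hty with ⟨rfl, -⟩ | ⟨rfl, -⟩
    · left; simp [Prod.ext_iff, site_two_eq_iff, e0, e1]
    · right; simp [Prod.ext_iff, site_two_eq_iff, e0, e1]
  · obtain ⟨h1, h2, h3, h4⟩ := r5.1 hw
    show (x, t) = faceL y 5 ∨ (x, t) = faceL y (5 + 1)
    rw [f5, show (5 : Fin 6) + 1 = 0 from rfl, f0]
    have e0 : x 0 = y 0 := int_eq_of_lt_of_lt (by linarith) (by linarith)
    have e0' : (x 0 : ℝ) = y 0 := by exact_mod_cast e0
    rcases hty with ⟨rfl, h5⟩ | ⟨rfl, h5⟩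
    · right
      have e1 : x 1 = y 1 := int_eq_of_lt_of_lt (by linarith) (by linarith)
      simp [Prod.ext_iff, site_two_eq_iff, e0, e1]
    · left
      have e1 : x 1 = y 1 - 1 := int_eq_of_lt_of_lt (by push_cast; linarith) (by push_cast; linarith)
      simp [Prod.ext_iff, site_two_eq_iff, e0, e1]

/-! ### 2. The two open cells along an edge -/

/-- Lattice coordinates of the edge point `triEmbed b + θ·triEmbed (triDir m)`. [folklore] -/
theorem coords_edgePoint (b : Site 2) (m : Fin 6) (θ : ℝ) :
    triX (triEmbed b + (θ : ℂ) * triEmbed (triDir m)) = b 0 + θ * (![1, 0, -1, -1, 0, 1] : Fin 6 → ℝ) m ∧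
    triY (triEmbed b + (θ : ℂ) * triEmbed (triDir m)) = b 1 + θ * (![0, 1, 1, 0, -1, -1] : Fin 6 → ℝ) m := by
  rw [triX_add, triY_add, triX_smul, triY_smul, triX_triEmbed, triY_triEmbed, triX_triEmbed, triY_triEmbed,
    triDir_fst_cast, triDir_snd_cast]; exact ⟨rfl, rfl⟩

/-- **The side normal is the direction turned left**: `innerNormal (σ m) = I · triEmbed (triDir m)`.
[folklore] -/
theorem innerNormal_sigma_eq (m : Fin 6) :
    innerNormal (![0, 3, 5, 1, 2, 4] m) = Complex.I * triEmbed (triDir m) := by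
  fin_cases m <;> apply Complex.ext <;> simp [triEmbed, triDir, innerNormal_eq, triZeta_re, triZeta_im] <;> norm_num

/-- The directions are unit vectors: `conj u · u = 1`. [folklore] -/
theorem conj_triDir_mul_self (m : Fin 6) : conj (triEmbed (triDir m)) * triEmbed (triDir m) = 1 := by
  have h3 : Real.sqrt 3 * Real.sqrt 3 = 3 := Real.mul_self_sqrt (by norm_num)
  fin_cases m <;> apply Complex.ext <;>
    simp [triEmbed, triDir, triZeta_re, triZeta_im, Complex.mul_re, Complex.mul_im] <;> nlinarith [h3]

/-- The directions are unit vectors. [folklore] -/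
theorem norm_triEmbed_triDir (m : Fin 6) : ‖triEmbed (triDir m)‖ = 1 := by
  have h2 : ‖conj (triEmbed (triDir m)) * triEmbed (triDir m)‖ = 1 := by rw [conj_triDir_mul_self, norm_one]
  rw [norm_mul, Complex.norm_conj] at h2
  nlinarith [norm_nonneg (triEmbed (triDir m))]

/-- **A vector orthogonal to `I·u` (`u` a unit vector) is its projection on `u`.** [folklore] -/
theorem eq_proj_of_level_zero {u v : ℂ} (hu : conj u * u = 1) (h : (v * conj (Complex.I * u)).re = 0) :
    v = ((v * conj u).re : ℂ) * u := by
  have him : (v * conj u).im = 0 := by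
    rw [map_mul, Complex.conj_I] at h
    have : v * (-Complex.I * conj u) = -Complex.I * (v * conj u) := by ring
    rw [this, Complex.mul_re] at h
    simpa using h
  have hre : ((v * conj u).re : ℂ) = v * conj u := by
    apply Complex.ext <;> simp [him]
  rw [hre, mul_assoc, hu, mul_one]

/-- The level against the side normal does not see the position along the edge. [folklore] -/
theorem level_edgePoint (b : Site 2) (m : Fin 6) (θ : ℝ) (w : ℂ) :
    ((w - (triEmbed b + (θ : ℂ) * triEmbed (triDir m))) * conj (innerNormal (![0, 3, 5, 1, 2, 4] m))).re =
      ((w - triEmbed b) * conj (innerNormal (![0, 3, 5, 1, 2, 4] m))).re := by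
  have h := level_split (innerNormal (![0, 3, 5, 1, 2, 4] m)) w (triEmbed b)
    (triEmbed b + (θ : ℂ) * triEmbed (triDir m))
  rw [level_add_smul, level_triDir_sigma, mul_zero, add_zero] at h
  exact h.symm

/-- **On the side line near the edge one is on the closed edge** (the along-edge coordinate
`t = θ + Re((w - z)·conj u)` is within `‖w - z‖` of `θ`). [folklore] -/
theorem mem_segment_of_level_zero (b : Site 2) (m : Fin 6) (θ : ℝ) (w : ℂ)
    (hw : ‖w - (triEmbed b + (θ : ℂ) * triEmbed (triDir m))‖ < min θ (1 - θ))
    (h0 : ((w - (triEmbed b + (θ : ℂ) * triEmbed (triDir m))) * conj (innerNormal (![0, 3, 5, 1, 2, 4] m))).re = 0) :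
    w ∈ segment ℝ (triEmbed b) (triEmbed (b + triDir m)) := by
  set u := triEmbed (triDir m) with hu
  set z := triEmbed b + (θ : ℂ) * u with hz
  have hunit := conj_triDir_mul_self m
  rw [innerNormal_sigma_eq] at h0
  have hproj := eq_proj_of_level_zero hunit h0
  set s : ℝ := ((w - z) * conj u).re with hs
  have hs_le : |s| ≤ ‖w - z‖ := by
    calc |s| ≤ ‖(w - z) * conj u‖ := Complex.abs_re_le_norm _
      _ = ‖w - z‖ := by
        rw [norm_mul, Complex.norm_conj]
        have : ‖u‖ = 1 := by
          have h2 : ‖conj u * u‖ = 1 := by rw [hunit, norm_one]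
          rw [norm_mul, Complex.norm_conj] at h2
          nlinarith [norm_nonneg u]
        rw [this, mul_one]
  have hθ1 : min θ (1 - θ) ≤ θ := min_le_left _ _
  have hθ2 : min θ (1 - θ) ≤ 1 - θ := min_le_right _ _
  have habs := abs_le.1 hs_le
  rw [segment_eq_image']
  refine ⟨θ + s, ⟨by linarith, by linarith⟩, ?_⟩
  simp only [triEmbed_add, add_sub_cancel_left, Complex.real_smul]
  rw [← hu]
  have : w = z + (s : ℂ) * u := by rw [← hproj, add_sub_cancel]
  rw [this, hz]
  push_cast
  ring

/-- Sign extraction: `0 < (√3/2)·F`. [folklore] -/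
theorem pos_of_level_pos {F : ℝ} (h : 0 < Real.sqrt 3 / 2 * F) : 0 < F :=
  (mul_pos_iff_of_pos_left sqrt_three_div_two_pos).1 h
/-- Sign extraction: `(√3/2)·F < 0`. [folklore] -/
theorem neg_of_level_neg {F : ℝ} (h : Real.sqrt 3 / 2 * F < 0) : F < 0 :=
  not_le.1 fun h' => absurd h (not_lt.2 (mul_nonneg sqrt_three_div_two_pos.le h'))
/-- Sign extraction: `0 < -((√3/2)·F)`. [folklore] -/
theorem neg_of_neg_level_pos {F : ℝ} (h : 0 < -(Real.sqrt 3 / 2 * F)) : F < 0 := neg_of_level_neg (by linarith)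
/-- Sign extraction: `-((√3/2)·F) < 0`. [folklore] -/
theorem pos_of_neg_level_neg {F : ℝ} (h : -(Real.sqrt 3 / 2 * F) < 0) : 0 < F := pos_of_level_pos (by linarith)

/-- **The edge-local trichotomy**: for `z = triEmbed b + θ·triEmbed (triDir m)` and
`4‖w - z‖ < min θ (1 - θ)`, according to the sign of the level of `w - z` against
`innerNormal (σ m)` the point `w` lies in the open LEFT cell `faceL b m`, in the open RIGHT cell
`faceL b (m+5)`, or on the closed edge. [folklore] -/
theorem edge_trichotomy (b : Site 2) (m : Fin 6) (θ : ℝ) (w : ℂ)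
    (hw : 4 * ‖w - (triEmbed b + (θ : ℂ) * triEmbed (triDir m))‖ < min θ (1 - θ)) :
    (0 < ((w - (triEmbed b + (θ : ℂ) * triEmbed (triDir m))) * conj (innerNormal (![0, 3, 5, 1, 2, 4] m))).re →
        w ∈ triCellStrict (faceL b m)) ∧
    (((w - (triEmbed b + (θ : ℂ) * triEmbed (triDir m))) * conj (innerNormal (![0, 3, 5, 1, 2, 4] m))).re < 0 →
        w ∈ triCellStrict (faceL b (m + 5))) ∧
    (((w - (triEmbed b + (θ : ℂ) * triEmbed (triDir m))) * conj (innerNormal (![0, 3, 5, 1, 2, 4] m))).re = 0 →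
        w ∈ segment ℝ (triEmbed b) (triEmbed (b + triDir m))) := by
  have hμ0 : 0 < min θ (1 - θ) := lt_of_le_of_lt (by positivity) hw
  have hseg := mem_segment_of_level_zero b m θ w (by linarith [norm_nonneg (w - (triEmbed b + (θ : ℂ) * triEmbed (triDir m)))])
  suffices H : (0 < ((w - (triEmbed b + (θ : ℂ) * triEmbed (triDir m))) * conj (innerNormal (![0, 3, 5, 1, 2, 4] m))).re →
        w ∈ triCellStrict (faceL b m)) ∧
      (((w - (triEmbed b + (θ : ℂ) * triEmbed (triDir m))) * conj (innerNormal (![0, 3, 5, 1, 2, 4] m))).re < 0 →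
        w ∈ triCellStrict (faceL b (m + 5))) from ⟨H.1, H.2, hseg⟩
  have hμ1 : min θ (1 - θ) ≤ θ := min_le_left _ _
  have hμ2 : min θ (1 - θ) ≤ 1 - θ := min_le_right _ _
  have hs := sqrt_three_div_two_pos
  obtain ⟨l0, l1, l2, l3, l4, l5⟩ := level_sub_triEmbed w b
  obtain ⟨s0, s1, s2, s3, s4, s5⟩ := triCellStrict_faceL_iff b w
  have hX := abs_triX_sub_le w (triEmbed b + (θ : ℂ) * triEmbed (triDir m))
  have hY := abs_triY_sub_le w (triEmbed b + (θ : ℂ) * triEmbed (triDir m))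
  have cXY := coords_edgePoint b m θ
  have hlev := level_edgePoint b m θ w
  rw [cXY.1] at hX
  rw [cXY.2] at hY
  rw [hlev]
  have hX' := abs_le.1 hX
  have hY' := abs_le.1 hY
  clear hseg cXY hlev hX hY
  have hm : m = 0 ∨ m = 1 ∨ m = 2 ∨ m = 3 ∨ m = 4 ∨ m = 5 := by fin_cases m <;> simp
  rcases hm with rfl | rfl | rfl | rfl | rfl | rfl <;>
    simp only [Fin.isValue, Fin.reduceAdd, Matrix.cons_val, Matrix.cons_val_zero, mul_one, mul_zero, mul_neg,
      add_zero] at hX' hY' ⊢ <;>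
    simp only [l0, l1, l2, l3, l4, l5, s0, s1, s2, s3, s4, s5] <;>
    obtain ⟨hX1, hX2⟩ := hX' <;> obtain ⟨hY1, hY2⟩ := hY' <;>
    constructor <;> intro h <;>
    (first
      | have h' := pos_of_level_pos h
      | have h' := neg_of_level_neg h
      | have h' := neg_of_neg_level_pos h
      | have h' := pos_of_neg_level_neg h) <;>
    refine ⟨?_, ?_, ?_⟩ <;> linarith

/-- **The two open cells along an edge** (registered form, sub-goal of `stub_innerZigzagPolygon`): off the
ends of the edge of the dart `b → b + triDir m`, a nearby point lies in the open left cell, in the open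
right cell, or on the closed edge, according to the sign of its level against the side normal.
[folklore] -/
theorem edge_cells : ∀ (b : Site 2) (m : Fin 6) (θ : ℝ) (w : ℂ), 4 * ‖w - (triEmbed b + (θ : ℂ) * triEmbed (triDir m))‖ < min θ (1 - θ) → (0 < ((w - (triEmbed b + (θ : ℂ) * triEmbed (triDir m))) * (starRingEnd ℂ) (innerNormal (![0, 3, 5, 1, 2, 4] m))).re → w ∈ triCellStrict (faceL b m)) ∧ (((w - (triEmbed b + (θ : ℂ) * triEmbed (triDir m))) * (starRingEnd ℂ) (innerNormal (![0, 3, 5, 1, 2, 4] m))).re < 0 → w ∈ triCellStrict (faceL b (m + 5))) ∧ (((w - (triEmbed b + (θ : ℂ) * triEmbed (triDir m))) * (starRingEnd ℂ) (innerNormal (![0, 3, 5, 1, 2, 4] m))).re = 0 → w ∈ segment ℝ (triEmbed b) (triEmbed (b + triDir m))) :=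
  fun b m θ w hw => edge_trichotomy b m θ w hw

end Summit.CriticalPhenomena.SAWScalingLimit.Theorems.PolygonParitySqueeze.InnerZigzag

end
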